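import Summits.HodgeConjecture.HodgeConjecture.Theorems.K2LiuLineThetaKernelMirror
import Literature.NumberTheory.Weil1964.AdelicMetaplecticTwistCharacter
import HarnessLib

/-!
# Two line-theta kernels on the SAME dual pair `U(diag d_V) × U(⟨a⟩)` at two splitting characters differ by an automorphic character of the pair
# — organ (O44e) of socket #44∕45R (slot 2: `λ̃⁻¹ ↦ λ̃` without complex conjugation)

Track B ∕ hLiu418 = stmt-HodgeConjecture-24832, line `K2_Liu_CurveThetaSigs`, unit U6 ED. 6, socket #44∕45R `sig_K2LiuUndoublingSeparation`;
seat `hodgecm-mathlib-K2Liu-p03` (g3).  The hypothesis-side kernels of #44∕45R sit at `χ_D = toHeckeCharacter λ⁻¹` (package (B)), the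
conclusion's slot 2 at `toHeckeCharacter λ` with NO complex conjugation; the two `μ`-attached splittings ★ `chiSplittingLine` of the SAME
dual pair `U(diag d_V) × U(⟨a⟩)` are both compatible for the same `splittingDatum` ([GelbartRogawski1991, Prop. 3.1.1]) and continuous,
so they differ by a CONTINUOUS character `η` of `G₁(𝔸) = U(diag d_V ⊗ ⟨a⟩)(𝔸_{L⁺})` (★ `adelicMpCont.exists_eq_twist_continuous`, the
torsor half of [GelbartRogawski1991, §3.1 Remark p. 457 L9–13]: «`s* = s ⊗ ν′`»), trivial on `G₁(L⁺)` (both carry `G₁(L⁺)` into Weil's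
rational section over the same `ι`, ★ `IsCompatible.apply_eq_ratSplit`); on the theta kernels `θ_Φ(x, q) = Θ(ω(s(x⁻¹ ⊗ 1 · 1 ⊗ q⁻¹))Φ)`
this reads, for ALL `Φ, x, q` (model currency of ★ `lineThetaKer_mk_eq_thetaDistLM`):

* **`exists_twist_lineThetaKer`** — `∃ η` continuous, `η|_{G₁(L⁺)} = 1`, with
  `θ_{Φ,μ₂}(mk x, mk q) = η(x⁻¹ ⊗ 1 · 1 ⊗ q⁻¹) · θ_{Φ,μ₁}(mk x, mk q)`; the character splits as `η(x⁻¹ ⊗ 1) · η(1 ⊗ q⁻¹)`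
  (`exists_twist_lineThetaKer_split`), its `x`-part being [HarrisKudlaSweet1996, (1.30)]'s `χ(det g₂)^{±1}` (★ `chiSplittingLine_mul_ratioHecke`
  pins it as `α ∘ det`; the socket's EXISTENTIAL slot-2 weight `W₂` (E6) and `q`-weight `f′` only need the abstract `η`).

No definition, no instance, no named fact, no `sorry`; axioms ⊆ {propext, Classical.choice, Quot.sound}.

## References
* [GelbartRogawski1991] S. Gelbart, J. Rogawski, Invent. Math. 105 (1991), §3.1 Prop. 3.1.1 p. 455 L1–3, Remark p. 457 L4–13; §3.2 p. 457.
* [HarrisKudlaSweet1996] M. Harris, S. Kudla, W. J. Sweet, J. AMS 9 (1996), §1 (1.14)–(1.15), (1.30), Cor. A.3 p. 998.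
* [Kudla1994] S. Kudla, Israel J. Math. 87 (1994), §3 Thm. 3.1.
* [Weil1964] A. Weil, Acta Math. 111 (1964), Chap. III n° 41 Thm. 6 p. 193.

HONEST LABEL: HC_CM is proved only modulo the 7 printed citations (2 remaining named inputs: hLiu418 = stmt-HodgeConjecture-24832, h413 =
stmt-HodgeConjecture-24833) until rung 0 closes; this helper moves no counter.
-/

set_option autoImplicit false

set_option linter.dupNamespace false

noncomputable section

open scoped Classical
open scoped Matrix Kronecker
open NumberField IsDedekindDomain
open Literature.RepresentationTheory.HeisenbergGroup
open Literature.NumberTheory.Automorphic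
open Literature.NumberTheory.Weil1964
open Literature.NumberTheory.GaloisRepresentations

namespace Summit.HodgeConjecture.HodgeConjecture.Cruxes.HLiu418.K2LiuLineThetaKernelCharTwist

open Literature.NumberTheory.Automorphic.UnitaryGroup
open Literature.NumberTheory.Automorphic.IdeleClassGroup
open Literature.NumberTheory.GelbartRogawski1991 Literature.NumberTheory.GelbartRogawski1991.UnitaryDualPair
open Literature.NumberTheory.GelbartRogawski1991.GRConstruction
open Literature.NumberTheory.Automorphic.Liu2021 Literature.NumberTheory.Automorphic.Liu2021.Def411WeilCarriers
open Literature.NumberTheory.Automorphic.Liu2021.Def411WeilCarriersDoubling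
open Literature.RepresentationTheory.Liu2021
open Summit.HodgeConjecture.HodgeConjecture.Cruxes.HLiu418.K2LiuLineThetaKernelMirror

/-! ## §1 Generic: two continuous compatible splittings of one dual-pair datum differ by an automorphic character -/

section Generic

variable {F E : Type} [Field F] [NumberField F] [Field E] [NumberField E] [Algebra F E]
  {c : E ≃ₐ[F] E} {N M n : ℕ} {e : Fin N × Fin M ≃ Fin n}
  {JV : Matrix (Fin N) (Fin N) E} {JW : Matrix (Fin M) (Fin M) E}
  {TV : Matrix (Fin N) (Fin N) F} {TW : Matrix (Fin M) (Fin M) F}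
  [Algebra.IsQuadraticExtension F E] {δ : E} {hcδ : c δ = -δ} {hδ : δ ≠ 0} {d : F} {hd : δ * δ = algebraMap F E d}
  {hV : TV.IsSymm} {hW : TW.IsSymm} {hVd : IsUnit TV.det} {hWd : IsUnit TW.det}
  {hJV : JV = TV.map (algebraMap F E)} {hJW : JW = TW.map (algebraMap F E)}
  {s₁ s₂ : UnitaryGroup.adelicPair F E c N M JV JW →* adelicMpCont F (Fin n) (adelicGram F e TV TW)}

/-- **Two CONTINUOUS compatible splittings of the same datum differ by a continuous character trivial on `G₁(F)`** — the torsor half of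
[GelbartRogawski1991, §3.1 Remark p. 457 L9–13] («`s* = s ⊗ ν′`, `ν′` automorphic»): `η` continuous from ★ `adelicMpCont.exists_eq_twist_continuous`
(both splittings lie over `ι`), and `η γ = 1` on `G₁(F)` because both carry `γ` to Weil's rational section over `ι γ`
(★ `IsCompatible.apply_eq_of_mem_ratPts`, ★ `adelicMpCont.ofScalar_injective`). [cite: GelbartRogawski1991, §3.1 Prop. 3.1.1 p. 455 L1–3, Remark p. 457 L4–13] -/
theorem exists_twist_of_isCompatible
    (hs₁ : (splittingDatum F E c N M e JV JW hcδ hδ hd hV hW hVd hWd hJV hJW).IsCompatible s₁)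
    (hs₂ : (splittingDatum F E c N M e JV JW hcδ hδ hd hV hW hVd hWd hJV hJW).IsCompatible s₂)
    (hc₁ : Continuous s₁) (hc₂ : Continuous s₂) :
    ∃ η : UnitaryGroup.adelicPair F E c N M JV JW →* ℂˣ, Continuous η ∧
      (∀ γ ∈ (UnitaryGroup.rationalPairToAdelic F E c N M JV JW).range, η γ = 1) ∧
      s₂ = adelicMpCont.twist F (Fin n) (adelicGram F e TV TW) s₁ η := by
  obtain ⟨η, hηc, hη⟩ := adelicMpCont.exists_eq_twist_continuous s₁ s₂ (isUnit_adelicGram F e hVd hWd)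
    (fun g => (hs₁.1 g).trans (hs₂.1 g).symm) hc₁ hc₂
  refine ⟨η, hηc, fun γ hγ => ?_, hη⟩
  -- on `G₁(F)` both splittings are Weil's rational section over `ι γ`
  have e1 : s₂ γ = s₁ γ := SplittingDatum.IsCompatible.apply_eq_of_mem_ratPts hs₁ hs₂ hγ
  have e2 : adelicMpCont.ofScalar F (Fin n) (adelicGram F e TV TW) (η γ) * s₁ γ = 1 * s₁ γ :=
    (adelicMpCont.twist_apply _ η γ).symm.trans (((DFunLike.congr_fun hη γ).symm.trans e1).trans (one_mul _).symm)
  exact adelicMpCont.ofScalar_injective ((mul_right_cancel e2).trans (map_one _).symm)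

end Generic

/-! ## §2 The line-theta kernels at two `μ`-attached splittings -/

variable (L : Type) [Field L] [NumberField L] [IsCMField L] (N : ℕ) {n' : ℕ} (e₁ : Fin N × Fin 1 ≃ Fin n')
  (dV : Fin N → L) (hdV : ∀ i, IsCMField.complexConj L (dV i) = dV i) (hdV0 : ∀ i, dV i ≠ 0) (a : (Fp L)ˣ)
  (μ₁ : Literature.NumberTheory.Automorphic.IdeleClassGroup L →ₜ* Circle) (hμ₁ : IsConjugateSymplectic L μ₁)
  (μ₂ : Literature.NumberTheory.Automorphic.IdeleClassGroup L →ₜ* Circle) (hμ₂ : IsConjugateSymplectic L μ₂)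
  (hρ₁ : HasThetaMajorants fun
    (p : ↥(UnitaryGroup.adelic (Fp L) L (IsCMField.complexConj L) N (Matrix.diagonal dV)) ×
      ↥(UnitaryGroup.adelic (Fp L) L (IsCMField.complexConj L) 1 (JW (Fp L) L a)))
    (Φ : piSchwartzBruhat (Fp L) (Fin n')) =>
      pairRep (Fp L) L (IsCMField.complexConj L) N 1 e₁ (Matrix.diagonal dV) (JW (Fp L) L a)
        (chiSplittingLine L e₁ dV hdV hdV0 (toHeckeCharacter L μ₁) (isUnitary_toHeckeCharacter L μ₁)
          ((isOscillatorChar_toHeckeCharacter_iff μ₁).mpr hμ₁) (TW (Fp L) a) (isUnit_det_TW (Fp L) a) (JW (Fp L) L a) (JW_eq (Fp L) L a))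
        p Φ)
  (hρ₂ : HasThetaMajorants fun
    (p : ↥(UnitaryGroup.adelic (Fp L) L (IsCMField.complexConj L) N (Matrix.diagonal dV)) ×
      ↥(UnitaryGroup.adelic (Fp L) L (IsCMField.complexConj L) 1 (JW (Fp L) L a)))
    (Φ : piSchwartzBruhat (Fp L) (Fin n')) =>
      pairRep (Fp L) L (IsCMField.complexConj L) N 1 e₁ (Matrix.diagonal dV) (JW (Fp L) L a)
        (chiSplittingLine L e₁ dV hdV hdV0 (toHeckeCharacter L μ₂) (isUnitary_toHeckeCharacter L μ₂)
          ((isOscillatorChar_toHeckeCharacter_iff μ₂).mpr hμ₂) (TW (Fp L) a) (isUnit_det_TW (Fp L) a) (JW (Fp L) L a) (JW_eq (Fp L) L a))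
        p Φ)

/-- **The two `μ`-attached line splittings of one dual pair differ by a continuous character trivial on the rational points**:
`ι_{μ₂} = ι_{μ₁} ⊗ η` (§1 at ★ `isCompatible_chiSplittingLine`, ★ `continuous_chiSplittingLine`).
[cite: GelbartRogawski1991, §3.1 Prop. 3.1.1 p. 455 L1–3, Remark p. 457 L4–13] [cite: Kudla1994, §3 Thm. 3.1] -/
theorem exists_twist_chiSplittingLine :
    ∃ η : UnitaryGroup.adelicPair (Fp L) L (IsCMField.complexConj L) N 1 (Matrix.diagonal dV) (JW (Fp L) L a) →* ℂˣ,
      Continuous η ∧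
      (∀ γ ∈ (UnitaryGroup.rationalPairToAdelic (Fp L) L (IsCMField.complexConj L) N 1 (Matrix.diagonal dV) (JW (Fp L) L a)).range,
        η γ = 1) ∧
      chiSplittingLine L e₁ dV hdV hdV0 (toHeckeCharacter L μ₂) (isUnitary_toHeckeCharacter L μ₂)
          ((isOscillatorChar_toHeckeCharacter_iff μ₂).mpr hμ₂) (TW (Fp L) a) (isUnit_det_TW (Fp L) a) (JW (Fp L) L a) (JW_eq (Fp L) L a) =
        adelicMpCont.twist (Fp L) (Fin n') (adelicGram (Fp L) e₁ (realDiagonal L dV hdV) (TW (Fp L) a))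
          (chiSplittingLine L e₁ dV hdV hdV0 (toHeckeCharacter L μ₁) (isUnitary_toHeckeCharacter L μ₁)
            ((isOscillatorChar_toHeckeCharacter_iff μ₁).mpr hμ₁) (TW (Fp L) a) (isUnit_det_TW (Fp L) a) (JW (Fp L) L a) (JW_eq (Fp L) L a))
          η :=
  exists_twist_of_isCompatible
    (isCompatible_chiSplittingLine L e₁ dV hdV hdV0 (toHeckeCharacter L μ₁) (isUnitary_toHeckeCharacter L μ₁)
      ((isOscillatorChar_toHeckeCharacter_iff μ₁).mpr hμ₁) (TW (Fp L) a) (isSymm_TW (Fp L) a) (isUnit_det_TW (Fp L) a) (JW (Fp L) L a)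
      (JW_eq (Fp L) L a))
    (isCompatible_chiSplittingLine L e₁ dV hdV hdV0 (toHeckeCharacter L μ₂) (isUnitary_toHeckeCharacter L μ₂)
      ((isOscillatorChar_toHeckeCharacter_iff μ₂).mpr hμ₂) (TW (Fp L) a) (isSymm_TW (Fp L) a) (isUnit_det_TW (Fp L) a) (JW (Fp L) L a)
      (JW_eq (Fp L) L a))
    (continuous_chiSplittingLine L e₁ dV hdV hdV0 (toHeckeCharacter L μ₁) (isUnitary_toHeckeCharacter L μ₁)
      ((isOscillatorChar_toHeckeCharacter_iff μ₁).mpr hμ₁) (TW (Fp L) a) (isUnit_det_TW (Fp L) a) (JW (Fp L) L a) (JW_eq (Fp L) L a))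
    (continuous_chiSplittingLine L e₁ dV hdV hdV0 (toHeckeCharacter L μ₂) (isUnitary_toHeckeCharacter L μ₂)
      ((isOscillatorChar_toHeckeCharacter_iff μ₂).mpr hμ₂) (TW (Fp L) a) (isUnit_det_TW (Fp L) a) (JW (Fp L) L a) (JW_eq (Fp L) L a))

/-- **THE TWO LINE-THETA KERNELS DIFFER BY THE CHARACTER** (★ `thetaKer` on representatives): there is a continuous `η : G₁(𝔸) →* ℂˣ`, trivial on
`G₁(L⁺)`, with `θ_{Φ,μ₂}(x, q) = η(x⁻¹ ⊗ 1 · 1 ⊗ q⁻¹) · θ_{Φ,μ₁}(x, q)` for ALL `Φ, x, q` — `θ_Φ(x, q) = Θ(ω(s(x⁻¹ ⊗ 1 · 1 ⊗ q⁻¹))Φ)` on both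
sides (★ `lineThetaKer_mk_eq_thetaDistLM`), `ω(s₂ g) = η(g) • ω(s₁ g)` (★ `adelicMpCont.omega_eq_smul_of_eq_twist`) and linearity of `Θ`.
[cite: GelbartRogawski1991, §3.1 Remark p. 457 L4–13; §3.2 p. 457] [cite: HarrisKudlaSweet1996, §1 (1.30)] [cite: Weil1964, Chap. III n° 41 Thm. 6 p. 193] -/
theorem exists_twist_lineThetaKer :
    ∃ η : UnitaryGroup.adelicPair (Fp L) L (IsCMField.complexConj L) N 1 (Matrix.diagonal dV) (JW (Fp L) L a) →* ℂˣ,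
      Continuous η ∧
      (∀ γ ∈ (UnitaryGroup.rationalPairToAdelic (Fp L) L (IsCMField.complexConj L) N 1 (Matrix.diagonal dV) (JW (Fp L) L a)).range,
        η γ = 1) ∧
      ∀ (Φ : piSchwartzBruhat (Fp L) (Fin n')) (x : UnitaryGroup.adelic (Fp L) L (IsCMField.complexConj L) N (Matrix.diagonal dV))
        (q : UnitaryGroup.adelic (Fp L) L (IsCMField.complexConj L) 1 (JW (Fp L) L a)),
        (lineThetaKernelDatum L N e₁ dV hdV hdV0 μ₂ hμ₂ a hρ₂).thetaKer Φ (QuotientGroup.mk x, QuotientGroup.mk q) =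
          ((η (UnitaryGroup.adelicInl (Fp L) L (IsCMField.complexConj L) N 1 _ _ x⁻¹ *
              UnitaryGroup.adelicInr (Fp L) L (IsCMField.complexConj L) N 1 _ _ q⁻¹) : ℂˣ) : ℂ) *
            (lineThetaKernelDatum L N e₁ dV hdV hdV0 μ₁ hμ₁ a hρ₁).thetaKer Φ (QuotientGroup.mk x, QuotientGroup.mk q) := by
  obtain ⟨η, hηc, hηrat, hη⟩ := exists_twist_chiSplittingLine L N e₁ dV hdV hdV0 a μ₁ hμ₁ μ₂ hμ₂
  refine ⟨η, hηc, hηrat, fun Φ x q => ?_⟩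
  -- (term-level chaining: no `rw` motive over the line-theta telescopes)
  have hω := adelicMpCont.omega_eq_smul_of_eq_twist hη
    (UnitaryGroup.adelicInl (Fp L) L (IsCMField.complexConj L) N 1 (Matrix.diagonal dV) (JW (Fp L) L a) x⁻¹ *
      UnitaryGroup.adelicInr (Fp L) L (IsCMField.complexConj L) N 1 (Matrix.diagonal dV) (JW (Fp L) L a) q⁻¹) Φ
  refine (lineThetaKer_mk_eq_thetaDistLM L N e₁ dV hdV hdV0 μ₂ hμ₂ a hρ₂ Φ x q).trans ?_
  refine ((congrArg (thetaDistLM (Fp L) (Fin n')) hω).trans (LinearMap.map_smul _ _ _)).trans ?_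
  exact congrArg (fun t : ℂ => ((η _ : ℂˣ) : ℂ) * t) (lineThetaKer_mk_eq_thetaDistLM L N e₁ dV hdV hdV0 μ₁ hμ₁ a hρ₁ Φ x q).symm

/-- **the same with the character SPLIT into its `U(V)`- and `U(W)`-parts**: `θ_{Φ,μ₂}(x, q) = η(x⁻¹ ⊗ 1) · η(1 ⊗ q⁻¹) · θ_{Φ,μ₁}(x, q)`, both
parts continuous homomorphisms trivial on the rational points `U(diag d_V)(L⁺)`, `U(⟨a⟩)(L⁺)` (★ `adelicInl_toAdelic_mem_range`,
★ `adelicInr_toAdelic_mem_range`) — the `x`-part is the socket's existential slot-2 weight `W₂` (E6), the `q`-part its `q`-weight `f′`.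
[cite: GelbartRogawski1991, §3.1 Remark p. 457 L4–13] [cite: HarrisKudlaSweet1996, §1 (1.30)] -/
theorem exists_twist_lineThetaKer_split :
    ∃ (η₁ : UnitaryGroup.adelic (Fp L) L (IsCMField.complexConj L) N (Matrix.diagonal dV) →* ℂˣ)
      (η₂ : UnitaryGroup.adelic (Fp L) L (IsCMField.complexConj L) 1 (JW (Fp L) L a) →* ℂˣ),
      Continuous η₁ ∧ Continuous η₂ ∧
      (∀ γ ∈ (UnitaryGroup.toAdelic (Fp L) L (IsCMField.complexConj L) N (Matrix.diagonal dV)).range, η₁ γ = 1) ∧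
      (∀ γ ∈ (UnitaryGroup.toAdelic (Fp L) L (IsCMField.complexConj L) 1 (JW (Fp L) L a)).range, η₂ γ = 1) ∧
      ∀ (Φ : piSchwartzBruhat (Fp L) (Fin n')) (x : UnitaryGroup.adelic (Fp L) L (IsCMField.complexConj L) N (Matrix.diagonal dV))
        (q : UnitaryGroup.adelic (Fp L) L (IsCMField.complexConj L) 1 (JW (Fp L) L a)),
        (lineThetaKernelDatum L N e₁ dV hdV hdV0 μ₂ hμ₂ a hρ₂).thetaKer Φ (QuotientGroup.mk x, QuotientGroup.mk q) =
          ((η₁ x⁻¹ : ℂˣ) : ℂ) * ((η₂ q⁻¹ : ℂˣ) : ℂ) *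
            (lineThetaKernelDatum L N e₁ dV hdV hdV0 μ₁ hμ₁ a hρ₁).thetaKer Φ (QuotientGroup.mk x, QuotientGroup.mk q) := by
  obtain ⟨η, hηc, hηrat, hη⟩ := exists_twist_lineThetaKer L N e₁ dV hdV hdV0 a μ₁ hμ₁ μ₂ hμ₂ hρ₁ hρ₂
  refine ⟨η.comp (UnitaryGroup.adelicInl (Fp L) L (IsCMField.complexConj L) N 1 _ _),
    η.comp (UnitaryGroup.adelicInr (Fp L) L (IsCMField.complexConj L) N 1 _ _),
    hηc.comp (UnitaryGroup.continuous_adelicInl (Fp L) L (IsCMField.complexConj L) N 1 _ _),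
    hηc.comp (UnitaryGroup.continuous_adelicInr (Fp L) L (IsCMField.complexConj L) N 1 _ _), ?_, ?_, fun Φ x q => ?_⟩
  · rintro _ ⟨γ, rfl⟩
    exact hηrat _ (UnitaryGroup.adelicInl_toAdelic_mem_range (Fp L) L (IsCMField.complexConj L) N 1 _ _ γ)
  · rintro _ ⟨γ, rfl⟩
    exact hηrat _ (UnitaryGroup.adelicInr_toAdelic_mem_range (Fp L) L (IsCMField.complexConj L) N 1 _ _ γ)
  · refine (hη Φ x q).trans (congrArg (· * _) ?_)
    rw [map_mul, Units.val_mul, MonoidHom.comp_apply, MonoidHom.comp_apply]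

end Summit.HodgeConjecture.HodgeConjecture.Cruxes.HLiu418.K2LiuLineThetaKernelCharTwist

end
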